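import Mathlib
import Summits.KontsevichZagierPeriods.Zeta5Search.FourthOrderShapeData
import Summits.KontsevichZagierPeriods.Zeta5Search.SecondOrderCentre
import Summits.KontsevichZagierPeriods.Zeta5Search.SelfConjugateOddProof
import Summits.KontsevichZagierPeriods.Zeta5Search.SecondOrderAggregate
import HarnessLib

/-!
# ζ(5) search — THE FRAME EXPONENT: `E(T) = −M` unless every live class sits in the top layer (tools for THEOREM L5)

Cell `pub-zeta5` (HONEST FRAMING: systematic search; no irrationality claim unless certified), typer seat generation 13.
REPORT-gen2-g14 §2 bookkeeping.  The class clauses `LawA4Classes b p M T` describe every live class (multipole, exponent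
`E_x ∈ [−M, −M+3]`) as the frame type `T` with `E_x + M` raises (or, for odd `b₀`, as a self-conjugate class); the pair lemma of
THEOREM L5 needs the frame exponent `E(T) := Σ T = −M`.  This is NOT a consequence of the shape data alone (domination forgets the
raise count), so we count: a `k`-fold raise adds exactly `k` to the exponent (`typeExp_of_isRaiseN`), the class exponent is the list
exponent plus the odd-centre indicator (`classExp_eq_typeExp_add`), a self-conjugate single raise of a palindrome is impossible for an
odd-centre class (`even_of_pal_raise` + `odd_L_of_centre`), and a layer-2 class is never self-conjugate (`SelfConjugateOdd`, `M` even).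
Result (`typeExp_frame_or_top`): for every live class, `E(T) = −M` or `E_x = −M + 3`.  Integer bookkeeping; nothing here bears on
irrationality.
-/

namespace Summit.KontsevichZagierPeriods.Zeta5Search.SecondOrder

open Finset
open Summit.KontsevichZagierPeriods.Zeta5Search.CasoratianValuation (InPolytope)
open Summit.KontsevichZagierPeriods.Zeta5Search.ClusterValuation
open Summit.KontsevichZagierPeriods.Zeta5Search.LevelClass (typeExp typeExp_congr classSet_level level_injective)
open Summit.KontsevichZagierPeriods.Zeta5Search.CellKit (netExp_conj_level)
open Summit.KontsevichZagierPeriods.Zeta5Search.RecordWindowsA4 (LawA4Classes)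
open Summit.KontsevichZagierPeriods.Zeta5Search.SecondResidueLaw (isRaiseN)

variable {p : ℕ} [hp : Fact p.Prime]

/-! ## §1 The exponent of a raise -/

omit hp in
/-- A raise at a level `i ≤ L` adds `1` to the exponent. -/
theorem typeExp_raiseAt (e : ℕ → ℤ) {L i : ℕ} (hi : i ≤ L) : typeExp L (raiseAt e i) = typeExp L e + 1 := by
  have h : ∀ k, raiseAt e i k = e k + if k = i then 1 else 0 := fun k => by
    unfold raiseAt; split_ifs <;> ring
  simp only [typeExp, h, sum_add_distrib, sum_ite_eq', mem_range, show i < L + 1 by omega, if_true]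

omit hp in
/-- `1 :: T` adds `1` to the exponent. -/
theorem typeExp_consOne (e : ℕ → ℤ) (L : ℕ) : typeExp (L + 1) (consOne e) = typeExp L e + 1 := by
  unfold typeExp
  rw [sum_range_succ']
  simp [consOne]

omit hp in
/-- `T ++ [1]` adds `1` to the exponent. -/
theorem typeExp_snocOne (e : ℕ → ℤ) (L : ℕ) : typeExp (L + 1) (snocOne e L) = typeExp L e + 1 := by
  unfold typeExp
  rw [sum_range_succ]
  congr 1
  · exact sum_congr rfl fun k hk => by
      have := mem_range.1 hk
      simp [snocOne, show k ≠ L + 1 by omega]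
  · simp [snocOne]

omit hp in
/-- **A `k`-fold raise adds exactly `k` to the exponent.** -/
theorem typeExp_of_isRaiseN : ∀ (k : ℕ) (T S : List ℤ), isRaiseN k T S = true → S ≠ [] →
    typeExp (tTop S) (tList S) = typeExp (tTop T) (tList T) + k := by
  intro k
  induction k with
  | zero =>
    intro T S h _
    rw [(isRaiseN_zero_iff T S).1 h]; simp
  | succ k ih =>
    intro T S h hS
    rw [isRaiseN_succ_iff] at h
    by_cases hT : T = []
    · subst hT
      have h1 : isRaiseN k [1] S = true := by
        rcases h with ⟨i, hi, _⟩ | h | h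
        · simp at hi
        · simpa using h
        · simpa using h
      have h1T : typeExp (tTop [(1 : ℤ)]) (tList [(1 : ℤ)]) = 1 := by simp [typeExp, tTop, tList]
      have h0T : typeExp (tTop ([] : List ℤ)) (tList []) = 0 := by simp [typeExp, tTop, tList]
      rw [ih [1] S h1 hS, h1T, h0T]
      push_cast; ring
    obtain ⟨hr, hc, hs⟩ := tData_raises hT
    rcases h with ⟨i, hi, hUS⟩ | hUS | hUS
    · rw [ih _ S hUS hS, (hr i).1, typeExp_congr (hr i).2,
        typeExp_raiseAt _ (by have := List.length_pos_iff.2 hT; unfold tTop; omega)]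
      push_cast; ring
    · rw [ih _ S hUS hS, hc.1, typeExp_congr hc.2, typeExp_consOne]
      push_cast; ring
    · rw [ih _ S hUS hS, hs.1, typeExp_congr hs.2, typeExp_snocOne]
      push_cast; ring

/-! ## §2 Class exponent versus list exponent -/

section Cls

variable (b : ℕ → ℤ) {x : ℕ} (hx : x < p) (hxn : x ≤ (b 0).toNat)
include hx hxn

/-- **`E_x = E(type list) + [odd centre]`.** -/
theorem classExp_eq_typeExp_add : classExp b p x =
    typeExp (tTop (classTypeList b p x)) (tList (classTypeList b p x)) + (if ¬ (2 : ℤ) ∣ b 0 ∧ CentreIn b p x then 1 else 0) := by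
  obtain ⟨hL, hL'⟩ := level_bounds' (p := p) b hxn
  obtain ⟨htop, hlev⟩ := spec_of_typeList (p := p) b hxn rfl
  unfold classExp typeExp
  rw [classSet_level b hx hL hL', sum_image (fun a _ c _ h => level_injective hp.out.pos x h), htop]
  congr 1
  exact sum_congr rfl fun k hk => hlev k (by have := mem_range.1 hk; omega)

/-- A class with `≥ 1` pole has a negative level exponent. -/
theorem exists_level_neg (h1 : 1 ≤ classPoleCount b p x) : ∃ i ≤ topLevel b p x, netExp b (x + i * p) < 0 := by
  obtain ⟨hL, hL'⟩ := level_bounds' (p := p) b hxn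
  by_contra hall
  push Not at hall
  have : classPoleCount b p x = 0 := by
    unfold classPoleCount
    rw [card_eq_zero, filter_eq_empty_iff]
    intro s hs
    rw [classSet_level b hx hL hL', mem_image] at hs
    obtain ⟨k, hk, rfl⟩ := hs
    exact not_lt.2 (hall k (by have := mem_range.1 hk; omega))
  omega

omit hx hxn in
omit hp in
/-- A multipole class has `ν = E`. -/
theorem classNu_eq_of_multipole (h2 : 2 ≤ classPoleCount b p x) : classNu b p x = classExp b p x := by
  by_contra hne
  have := (tame_of_classNu_ne b hne).1
  omega

omit hxn in
/-- **No odd-centre class is a single raise of the palindromic frame** (its length would be even and odd at once). -/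
theorem not_isRaise_of_centre (hb : InPolytope b) (hpn : (p : ℤ) ≤ b 0) {T : List ℤ} (hT : T.reverse = T) (hTne : T ≠ [])
    (h1 : 1 ≤ classPoleCount b p x) (hodd : ¬ (2 : ℤ) ∣ b 0) (hcen : CentreIn b p x)
    (hr : isRaise T (classTypeList b p x) = true) : False := by
  have h0 : 0 ≤ b 0 := hb.1.1
  have hxn : x ≤ (b 0).toNat := le_b0_of_lt b hpn hx
  have hpn' : p ≤ (b 0).toNat := by omega
  obtain ⟨hL, hL'⟩ := level_bounds' (p := p) b hxn
  have hcx : conjClass b p x = x := (centreIn_iff_conjClass_eq b hpn' hx).1 hcen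
  rw [classTypeList_level b hL hL', ← range_map_tList hTne] at hr
  have hfpal : ∀ k ≤ topLevel b p x, netExp b (x + (topLevel b p x - k) * p) = netExp b (x + k * p) := fun k hk => by
    rw [← netExp_conj_level b hL hL' h0 hk, hcx]
  have heven := even_of_pal_raise (tList_pal hT) hfpal (exists_level_neg b hx hxn h1) hr
  exact odd_L_of_centre b hx hL hL' hodd hcen h0 heven

end Cls

/-! ## §3 The dichotomy -/

/-- **For every live class, `E(T) = −M` or `E_x = −M + 3`.** -/
theorem typeExp_frame_or_top (b : ℕ → ℤ) (hb : InPolytope b) (hp5 : 5 ≤ p) (hpn : (p : ℤ) ≤ b 0) {M : ℕ} (hMe : Even M)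
    {T : List ℤ} (hT : T.reverse = T) (hC : LawA4Classes b p M T) {x : ℕ} (hx : x < p) (h2 : 2 ≤ classPoleCount b p x)
    (hE3 : classExp b p x ≤ -(M : ℤ) + 3) :
    typeExp (tTop T) (tList T) = -(M : ℤ) ∨ classExp b p x = -(M : ℤ) + 3 := by
  have hxn : x ≤ (b 0).toNat := le_b0_of_lt b hpn hx
  have hmem : x ∈ multipoleClasses b p := mem_filter.2 ⟨mem_range.2 hx, h2⟩
  obtain ⟨c1, -, c3, c4, c5⟩ := hC
  have hEm := c1 x hmem
  have hν := classNu_eq_of_multipole b h2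
  have hcls := classExp_eq_typeExp_add b hx hxn
  have hSne : classTypeList b p x ≠ [] := classTypeList_ne_nil b p x
  have h1 : 1 ≤ classPoleCount b p x := by omega
  rcases (show classExp b p x = -(M : ℤ) ∨ classExp b p x = -(M : ℤ) + 1 ∨ classExp b p x = -(M : ℤ) + 2 ∨
      classExp b p x = -(M : ℤ) + 3 by omega) with h | h | h | h
  · obtain ⟨hnc, hST⟩ := c3 x hmem h
    rw [hST, if_neg (fun hc => hnc hc.2)] at hcls
    left; omega
  · rcases c4 x hx h1 (by rw [hν, h]) with hr | ⟨hodd, hcen, hST⟩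
    · have hk := typeExp_of_isRaiseN 1 T _ (isRaiseN_one_of_isRaise hr) hSne
      by_cases hc : ¬ (2 : ℤ) ∣ b 0 ∧ CentreIn b p x
      · exfalso
        have hTne : T ≠ [] := by
          rintro rfl
          have h0T : typeExp (tTop ([] : List ℤ)) (tList []) = 0 := by simp [typeExp, tTop, tList]
          rw [if_pos hc] at hcls
          rw [h0T] at hk
          push_cast at hk
          omega
        exact not_isRaise_of_centre b hx hb hpn hT hTne h1 hc.1 hc.2 hr
      · rw [if_neg hc] at hcls
        left; push_cast at hk; omega
    · rw [hST, if_pos ⟨hodd, hcen⟩] at hcls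
      left; omega
  · have hk := typeExp_of_isRaiseN 2 T _ (isRaiseN_two_of_isRaise2 (c5 x hx h1 (by rw [hν, h]))) hSne
    by_cases hc : ¬ (2 : ℤ) ∣ b 0 ∧ CentreIn b p x
    · exfalso
      have hodd' := selfConjugateOdd_holds b p x hb hp.out hp5 hx h1 hc.2
      rw [h] at hodd'
      obtain ⟨m, hm⟩ := hMe
      obtain ⟨r, hr⟩ := hodd'
      omega
    · rw [if_neg hc] at hcls
      left; push_cast at hk; omega
  · exact Or.inr h

end Summit.KontsevichZagierPeriods.Zeta5Search.SecondOrder
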